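import Mathlib
import Summits.KontsevichZagierPeriods.Zeta5Search.Profile20CellsA
import Summits.KontsevichZagierPeriods.Zeta5Search.Profile20CellsB
import Summits.KontsevichZagierPeriods.Zeta5Search.DenomLaw.OriginCoverKit
import Summits.KontsevichZagierPeriods.Zeta5Search.DenomLaw.FullProfilePath
import Summits.KontsevichZagierPeriods.Zeta5Search.TopFamilyFPCasLB
import Summits.KontsevichZagierPeriods.Zeta5Search.DecompositionWholeCone
import HarnessLib

/-!
# ζ(5) search — PATH ACCOUNTING ON THE `N_p = 20` PROFILE OF THE FIRST PERIOD FOR EVERY SORTED PARAMETER VECTOR (general `b`; THEOREM LB / Lemma-D / the ORIGIN law at `M = 8`)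

Cell `pub-zeta5` (HONEST FRAMING: systematic search; no irrationality claim unless certified), TRACK «DENOM-LAW» D1 prover seat
(denom-prover-d1 g17, `HOME/denom-law/prover-d1/ATTEMPT-17.md` §C).  Companion of `DenomLaw/FullProfilePath` (the node
`DenomLaw.PathAccountingFirstPeriod` for EVERY sorted `b` on the full profile `N_p = 21`).  Here: the profile ONE BLOCK SHORT OF FULL — all seven
parameters reach `p` and every pair block but the smallest one does: `p ≤ b₇`, `b₀ − b₁ − b₂ < p ≤ b₀ − b₁ − b₃` (inside the first period) — for EVERY
sorted `b` of the polytope, no ray or family.  Then `N_p = 20` (`pairFloors_eq_20`), `C⋆ ≤ 11`, `p < d < 4p` (`d` expanded by the tree's `DecompositionWholeCone.dOf_expand`) (so `⌊d/p⌋ ∈ {1, 2, 3}`, both bounds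
PROVED from the profile), and the node asks `⌊d/p⌋ − 14`: `−13 / −12 / −11`.  MECHANISM (three landed rungs of the tree, read on the machine-generated
general-`b` covers `FullProfile.cover20_ev / cover20_od` of `Profile20Cells{A,B}`, 32 + 31 types):
* `⌊d/p⌋ = 1`: THEOREM LB (`casoratianClassBound_holds`) — `checkLB` at `(A, B) = (−8, −5)`: `casLB ≥ −13` (`cas_ge20_neg13`);
* `⌊d/p⌋ = 2`: the Lemma-D bonus (`ClassTypeGuards.lemmaD_of_cover` via `TopFamFP.cover_J_j`) at the least multipole exponent `m = −8` (deep classes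
  `[1,−6,−4,1]` / `[1,−4,−6,1]`, one live type up to conjugation, the palindrome `[1,−5,−5,1]` dropped): `casLB + 1 = −12` (`cas_ge20_neg12`);
* `⌊d/p⌋ = 3`: the ORIGIN type-space law at `M = 8` (`DenomLaw.originClasses_of_cover` + `originBound_of_classes`) with the tree's universal inventory
  `Ray4Windows.D8`, `T1Rays.Pc8` and the sub-deep list `Ray4Windows.S8` EXTENDED by the two five-point raises `[1,1,−6,−4,1]`, `[1,−4,−6,1,1]`, whose pair
  points lie on the SAME line `u8 = (33, −49)`, `c8 = −174` (`s8x_pt_1/2`, `decide +kernel`; `lineData8x`): `5 − 2M = −11` (`cas_ge20_neg11`).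
Hence **`pathAccounting_profile20`** (every `j`) and **`pathAccountingFirstPeriod_profile20`** (the node's binders verbatim plus `p ≤ b₇`,
`b₀ < p + b₁ + b₂`, `p + b₁ + b₃ ≤ b₀`).  With `DenomLaw/FullProfilePath`: the node holds for every sorted `b` at every first-period prime at which
all seven parameters and at least twenty pair blocks reach `p` (the full profile needing `d < 4p`).  EVIDENCE BESIDE THE PROOF (ATTEMPT-17 §C,
`g17/code/profile20_*.py`): exhaustive `p ≤ 11` (8,077 instances): rung M 236/236 at `⌊d/p⌋ = 1`, J 6,011/6,011 at `2`, ORIGIN 1,830/1,830 at `3`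
(318 of them through the two new sub-deep types; exact `v = −11` at sampled instances).  MODEL/structure-side valuation bookkeeping of the cell's own
rationals; nothing about ζ(5); no γ; records in print UNMOVED.
-/

open Finset

namespace Summit.KontsevichZagierPeriods.Zeta5Search.FullProfile

open Summit.KontsevichZagierPeriods.Zeta5Search.ClusterValuation
open Summit.KontsevichZagierPeriods.Zeta5Search.CasoratianValuation (InPolytope shift casoratian pairFloors refund)
open Summit.KontsevichZagierPeriods.Zeta5Search.WedgeDictionary (dOf)
open Summit.KontsevichZagierPeriods.Zeta5Search.ClassTypeCover
open Summit.KontsevichZagierPeriods.Zeta5Search.DenomLaw (cStar FirstPeriod Sorted7 originClasses_of_cover originBound_of_classes)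
open Summit.KontsevichZagierPeriods.Zeta5Search.DenomLaw.FirstPeriodKit (cStar_le_eleven sorted7_chain firstPeriod_pair pairFloors_expand)
open Summit.KontsevichZagierPeriods.Zeta5Search.OriginWindows (OriginWindowClasses LineData lineVal)
open Summit.KontsevichZagierPeriods.Zeta5Search.ZeroWindows (pairPoint)
open Summit.KontsevichZagierPeriods.Zeta5Search.TypeEval (typeRho_eq_typeRhoC)
open Summit.KontsevichZagierPeriods.Zeta5Search.StairTS3 (refund_le_pathHead)
open Summit.KontsevichZagierPeriods.Zeta5Search.TopFamFP (cover_J_j)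
open Summit.KontsevichZagierPeriods.Zeta5Search.SortedProfile

/-! ## §1 The extended universal `M = 8` line data -/

set_option maxHeartbeats 8000000 in
/-- Line datum: the five-point sub-deep type `[1,1,−6,−4,1]` (a degree raise of the deep type `[1,−6,−4,1]`) has its pair point on the universal
`M = 8` line: `Φ_u8 = c8`. -/
theorem s8x_pt_1 : lineVal Ray4Windows.u8 (pairPoint [1, 1, -6, -4, 1]) = Ray4Windows.c8 := by
  unfold lineVal ZeroWindows.pairPoint LevelClass.typeW LevelClass.typeV; simp only [typeRho_eq_typeRhoC]; decide +kernel

set_option maxHeartbeats 8000000 in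
/-- Line datum: the conjugate five-point sub-deep type `[1,−4,−6,1,1]` has its pair point on the universal `M = 8` line. -/
theorem s8x_pt_2 : lineVal Ray4Windows.u8 (pairPoint [1, -4, -6, 1, 1]) = Ray4Windows.c8 := by
  unfold lineVal ZeroWindows.pairPoint LevelClass.typeW LevelClass.typeV; simp only [typeRho_eq_typeRhoC]; decide +kernel

/-- **The universal `M = 8` origin line data with the EXTENDED sub-deep list** `S8 ++ [[1,1,−6,−4,1], [1,−4,−6,1,1]]` (from `T1Rays.lineData8c`). -/
theorem lineData8x : LineData Ray4Windows.u8 Ray4Windows.c8 Ray4Windows.D8 (Ray4Windows.S8 ++ [[1, 1, -6, -4, 1], [1, -4, -6, 1, 1]]) T1Rays.Pc8 := by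
  obtain ⟨hD, hS, hP⟩ := T1Rays.lineData8c
  refine ⟨hD, ?_, hP⟩
  intro s hs
  rw [List.mem_append] at hs
  rcases hs with hs | hs
  · exact hS s hs
  · simp only [List.mem_cons, List.not_mem_nil, or_false] at hs
    rcases hs with rfl | rfl
    · exact s8x_pt_1
    · exact s8x_pt_2

/-! ## §2 The type-level checks of the three rungs on the two covers -/

/-- THEOREM LB at `(A, B) = (−8, −5)` and the Lemma-D checks at `m = −8` (fallback `checkLBx` at `(−8; −8, −4)`) on the `N_p = 20` types, `b₀` even. -/
theorem checkJ20_ev : checkLB false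
      [([1, -5, 1], true), ([1, -6, 1], false), ([1, 1, -6, 1], false), ([1, 0, -6, 1], false), ([1, -1, -6, 1], false), ([1, -2, -6, 1], false), ([1, -3, -6, 1], false), ([1, -4, -6, 1], false), ([1, -4, -5, 1], false), ([1, -4, -4, 1], false), ([1, -5, -5, 1], false), ([1, -5, -4, 1], false), ([1, -6, -4, 1], false), ([1, -6, -3, 1], false), ([1, -6, -2, 1], false), ([1, -6, -1, 1], false), ([1, -6, 0, 1], false), ([1, -6, 1, 1], false), ([1, 1, -5, 1, 1], true), ([1, 1, -6, -4, 1], false), ([1, 1, -6, -3, 1], false), ([1, 1, -6, -2, 1], false), ([1, 1, -6, -1, 1], false), ([1, 1, -6, 0, 1], false), ([1, 1, -6, 1, 1], false), ([1, 0, -5, 0, 1], true), ([1, 0, -6, 0, 1], false), ([1, 0, -6, 1, 1], false), ([1, -1, -6, 1, 1], false), ([1, -2, -6, 1, 1], false), ([1, -3, -6, 1, 1], false), ([1, -4, -6, 1, 1], false)]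
      (-8) (-5) = true ∧ checkJ false
      [([1, -5, 1], true), ([1, -6, 1], false), ([1, 1, -6, 1], false), ([1, 0, -6, 1], false), ([1, -1, -6, 1], false), ([1, -2, -6, 1], false), ([1, -3, -6, 1], false), ([1, -4, -6, 1], false), ([1, -4, -5, 1], false), ([1, -4, -4, 1], false), ([1, -5, -5, 1], false), ([1, -5, -4, 1], false), ([1, -6, -4, 1], false), ([1, -6, -3, 1], false), ([1, -6, -2, 1], false), ([1, -6, -1, 1], false), ([1, -6, 0, 1], false), ([1, -6, 1, 1], false), ([1, 1, -5, 1, 1], true), ([1, 1, -6, -4, 1], false), ([1, 1, -6, -3, 1], false), ([1, 1, -6, -2, 1], false), ([1, 1, -6, -1, 1], false), ([1, 1, -6, 0, 1], false), ([1, 1, -6, 1, 1], false), ([1, 0, -5, 0, 1], true), ([1, 0, -6, 0, 1], false), ([1, 0, -6, 1, 1], false), ([1, -1, -6, 1, 1], false), ([1, -2, -6, 1, 1], false), ([1, -3, -6, 1, 1], false), ([1, -4, -6, 1, 1], false)]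
      (-8) = true ∧ checkLBx false
      [([1, -5, 1], true), ([1, -6, 1], false), ([1, 1, -6, 1], false), ([1, 0, -6, 1], false), ([1, -1, -6, 1], false), ([1, -2, -6, 1], false), ([1, -3, -6, 1], false), ([1, -4, -6, 1], false), ([1, -4, -5, 1], false), ([1, -4, -4, 1], false), ([1, -5, -5, 1], false), ([1, -5, -4, 1], false), ([1, -6, -4, 1], false), ([1, -6, -3, 1], false), ([1, -6, -2, 1], false), ([1, -6, -1, 1], false), ([1, -6, 0, 1], false), ([1, -6, 1, 1], false), ([1, 1, -5, 1, 1], true), ([1, 1, -6, -4, 1], false), ([1, 1, -6, -3, 1], false), ([1, 1, -6, -2, 1], false), ([1, 1, -6, -1, 1], false), ([1, 1, -6, 0, 1], false), ([1, 1, -6, 1, 1], false), ([1, 0, -5, 0, 1], true), ([1, 0, -6, 0, 1], false), ([1, 0, -6, 1, 1], false), ([1, -1, -6, 1, 1], false), ([1, -2, -6, 1, 1], false), ([1, -3, -6, 1, 1], false), ([1, -4, -6, 1, 1], false)]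
      (-8) (-8) (-4) = true := by decide

/-- The same checks on the `N_p = 20` types, `b₀` odd. -/
theorem checkJ20_od : checkLB true
      [([1, -6, 1], false), ([1, 1, -6, 1], false), ([1, 0, -6, 1], false), ([1, -1, -6, 1], false), ([1, -2, -6, 1], false), ([1, -3, -6, 1], false), ([1, -4, -6, 1], false), ([1, -4, -5, 1], false), ([1, -4, -4, 1], true), ([1, -4, -4, 1], false), ([1, -5, -5, 1], true), ([1, -5, -5, 1], false), ([1, -5, -4, 1], false), ([1, -6, -4, 1], false), ([1, -6, -3, 1], false), ([1, -6, -2, 1], false), ([1, -6, -1, 1], false), ([1, -6, 0, 1], false), ([1, -6, 1, 1], false), ([1, 1, -6, -4, 1], false), ([1, 1, -6, -3, 1], false), ([1, 1, -6, -2, 1], false), ([1, 1, -6, -1, 1], false), ([1, 1, -6, 0, 1], false), ([1, 1, -6, 1, 1], false), ([1, 0, -6, 0, 1], false), ([1, 0, -6, 1, 1], false), ([1, -1, -6, 1, 1], false), ([1, -2, -6, 1, 1], false), ([1, -3, -6, 1, 1], false), ([1, -4, -6, 1, 1], false)]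
      (-8) (-5) = true ∧ checkJ true
      [([1, -6, 1], false), ([1, 1, -6, 1], false), ([1, 0, -6, 1], false), ([1, -1, -6, 1], false), ([1, -2, -6, 1], false), ([1, -3, -6, 1], false), ([1, -4, -6, 1], false), ([1, -4, -5, 1], false), ([1, -4, -4, 1], true), ([1, -4, -4, 1], false), ([1, -5, -5, 1], true), ([1, -5, -5, 1], false), ([1, -5, -4, 1], false), ([1, -6, -4, 1], false), ([1, -6, -3, 1], false), ([1, -6, -2, 1], false), ([1, -6, -1, 1], false), ([1, -6, 0, 1], false), ([1, -6, 1, 1], false), ([1, 1, -6, -4, 1], false), ([1, 1, -6, -3, 1], false), ([1, 1, -6, -2, 1], false), ([1, 1, -6, -1, 1], false), ([1, 1, -6, 0, 1], false), ([1, 1, -6, 1, 1], false), ([1, 0, -6, 0, 1], false), ([1, 0, -6, 1, 1], false), ([1, -1, -6, 1, 1], false), ([1, -2, -6, 1, 1], false), ([1, -3, -6, 1, 1], false), ([1, -4, -6, 1, 1], false)]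
      (-8) = true ∧ checkLBx true
      [([1, -6, 1], false), ([1, 1, -6, 1], false), ([1, 0, -6, 1], false), ([1, -1, -6, 1], false), ([1, -2, -6, 1], false), ([1, -3, -6, 1], false), ([1, -4, -6, 1], false), ([1, -4, -5, 1], false), ([1, -4, -4, 1], true), ([1, -4, -4, 1], false), ([1, -5, -5, 1], true), ([1, -5, -5, 1], false), ([1, -5, -4, 1], false), ([1, -6, -4, 1], false), ([1, -6, -3, 1], false), ([1, -6, -2, 1], false), ([1, -6, -1, 1], false), ([1, -6, 0, 1], false), ([1, -6, 1, 1], false), ([1, 1, -6, -4, 1], false), ([1, 1, -6, -3, 1], false), ([1, 1, -6, -2, 1], false), ([1, 1, -6, -1, 1], false), ([1, 1, -6, 0, 1], false), ([1, 1, -6, 1, 1], false), ([1, 0, -6, 0, 1], false), ([1, 0, -6, 1, 1], false), ([1, -1, -6, 1, 1], false), ([1, -2, -6, 1, 1], false), ([1, -3, -6, 1, 1], false), ([1, -4, -6, 1, 1], false)]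
      (-8) (-8) (-4) = true := by decide

/-! ## §3 The valuation bounds on the `N_p = 20` profile, every sorted `b`, every direction `j` -/

section Bounds

variable {b : ℕ → ℤ} {j p : ℕ}

/-- On the `N_p = 20` profile of the first period `p < d(b) < 4p` (both from the profile inequalities, sortedness and `b₁ < 2p`). -/
theorem d_bounds20 (hs : Sorted7 b) (hP : (p : ℤ) ≤ b 7) (hQ : b 0 < (p : ℤ) + b 1 + b 2) (hQ3 : (p : ℤ) + b 1 + b 3 ≤ b 0)
    (hF1 : b 1 < 2 * (p : ℤ)) (hF2 : b 0 < 2 * (p : ℤ) + b 6 + b 7) : (p : ℤ) < dOf b ∧ dOf b < 4 * (p : ℤ) := by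
  obtain ⟨h21, h32, h43, h54, h65, h76⟩ := sorted7_chain hs
  rw [DecompositionWholeCone.dOf_expand]; constructor <;> linarith

/-- **`N_p = 20`**: on this profile the smallest pair digit is `0` and the other twenty are `1`. -/
theorem pairFloors_eq_20 (hb : InPolytope b) (hs : Sorted7 b) (hp : 0 < p) (hQ : b 0 < (p : ℤ) + b 1 + b 2) (hQ3 : (p : ℤ) + b 1 + b 3 ≤ b 0)
    (hfp : FirstPeriod b p) : pairFloors b p = 20 := by
  obtain ⟨h21, h32, h43, h54, h65, h76⟩ := sorted7_chain hs
  obtain ⟨h0, hb1, hb2, -, -, -, -, -, hc1⟩ := box hb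
  have hp0 : (0 : ℤ) < p := by exact_mod_cast hp
  have one : ∀ z : ℤ, (p : ℤ) ≤ z → z ≤ 2 * (p : ℤ) - 1 → z / (p : ℤ) = 1 := fun z h1 h2 => by
    rw [Int.ediv_eq_iff_of_pos hp0]; constructor <;> linarith
  have zero : (b 0 - b 1 - b 2) / (p : ℤ) = 0 := Int.ediv_eq_zero_of_lt (by linarith) (by linarith)
  have U := fun (i k : ℕ) (hi : i < 7) (hk : k < 7) (hik : i < k) => firstPeriod_pair hfp hi hk hik
  rw [pairFloors_expand, zero,
    one _ (by linarith) (U 0 2 (by norm_num) (by norm_num) (by norm_num)),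
    one _ (by linarith) (U 0 3 (by norm_num) (by norm_num) (by norm_num)), one _ (by linarith) (U 0 4 (by norm_num) (by norm_num) (by norm_num)),
    one _ (by linarith) (U 0 5 (by norm_num) (by norm_num) (by norm_num)), one _ (by linarith) (U 0 6 (by norm_num) (by norm_num) (by norm_num)),
    one _ (by linarith) (U 1 2 (by norm_num) (by norm_num) (by norm_num)), one _ (by linarith) (U 1 3 (by norm_num) (by norm_num) (by norm_num)),
    one _ (by linarith) (U 1 4 (by norm_num) (by norm_num) (by norm_num)), one _ (by linarith) (U 1 5 (by norm_num) (by norm_num) (by norm_num)),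
    one _ (by linarith) (U 1 6 (by norm_num) (by norm_num) (by norm_num)), one _ (by linarith) (U 2 3 (by norm_num) (by norm_num) (by norm_num)),
    one _ (by linarith) (U 2 4 (by norm_num) (by norm_num) (by norm_num)), one _ (by linarith) (U 2 5 (by norm_num) (by norm_num) (by norm_num)),
    one _ (by linarith) (U 2 6 (by norm_num) (by norm_num) (by norm_num)), one _ (by linarith) (U 3 4 (by norm_num) (by norm_num) (by norm_num)),
    one _ (by linarith) (U 3 5 (by norm_num) (by norm_num) (by norm_num)), one _ (by linarith) (U 3 6 (by norm_num) (by norm_num) (by norm_num)),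
    one _ (by linarith) (U 4 5 (by norm_num) (by norm_num) (by norm_num)), one _ (by linarith) (U 4 6 (by norm_num) (by norm_num) (by norm_num)),
    one _ (by linarith) (U 5 6 (by norm_num) (by norm_num) (by norm_num))]
  norm_num

/-- **THEOREM LB on the `N_p = 20` profile, general `b`**: `v_p(Cas_j(b)) ≥ −13` (`casLB ≥ −13` from `checkLB` at `(−8, −5)`, or no pole class). -/
theorem cas_ge20_neg13 (hb : InPolytope b) (hs : Sorted7 b) (hbj : InPolytope (shift b j)) (hj1 : 1 ≤ j) (hj7 : j ≤ 7)
    (hprime : p.Prime) (hp5 : 5 ≤ p) (hwin : (b 0 + 2 : ℤ) < (p : ℤ) ^ 2) (hP : (p : ℤ) ≤ b 7) (hQ : b 0 < (p : ℤ) + b 1 + b 2)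
    (hQ3 : (p : ℤ) + b 1 + b 3 ≤ b 0) (hF1 : b 1 < 2 * (p : ℤ)) (hF2 : b 0 < 2 * (p : ℤ) + b 6 + b 7) (hcas : casoratian b j ≠ 0) :
    (-13 : ℤ) ≤ padicValRat p (casoratian b j) := by
  haveI : Fact p.Prime := ⟨hprime⟩
  have hp2 : p % 2 = 1 := Nat.odd_iff.1 (hprime.odd_of_ne_two (by omega))
  have hpd : (p : ℤ) ≤ dOf b := le_of_lt (d_bounds20 hs hP hQ hQ3 hF1 hF2).1
  have hv := casoratianClassBound_holds b j p hb hj1 hj7 hbj hprime hp5 hwin hcas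
  rcases Int.emod_two_eq_zero_or_one (b 0) with hr | hr
  · obtain ⟨h1, -, -⟩ := checkJ20_ev
    rcases casLB_ge_of_cover (cover20_ev hb hs hP hQ hQ3 hF1 hF2 hp5 hp2 hr) (by rw [oddFlag_false hr]; exact h1) (by norm_num) hpd with h0 | h
    · rw [h0] at hv; linarith
    · linarith
  · obtain ⟨h1, -, -⟩ := checkJ20_od
    rcases casLB_ge_of_cover (cover20_od hb hs hP hQ hQ3 hF1 hF2 hp5 hp2 hr) (by rw [oddFlag_true hr]; exact h1) (by norm_num) hpd with h0 | h
    · rw [h0] at hv; linarith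
    · linarith

/-- **The Lemma-D bonus on the `N_p = 20` profile, general `b`**: `v_p(Cas_j(b)) ≥ −12 = casLB + 1` (least multipole exponent `m = −8`, one live deep type
up to conjugation). -/
theorem cas_ge20_neg12 (hb : InPolytope b) (hs : Sorted7 b) (hbj : InPolytope (shift b j)) (hj1 : 1 ≤ j) (hj7 : j ≤ 7)
    (hprime : p.Prime) (hp5 : 5 ≤ p) (hwin : (b 0 + 2 : ℤ) < (p : ℤ) ^ 2) (hP : (p : ℤ) ≤ b 7) (hQ : b 0 < (p : ℤ) + b 1 + b 2)
    (hQ3 : (p : ℤ) + b 1 + b 3 ≤ b 0) (hF1 : b 1 < 2 * (p : ℤ)) (hF2 : b 0 < 2 * (p : ℤ) + b 6 + b 7) (hcas : casoratian b j ≠ 0) :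
    (-12 : ℤ) ≤ padicValRat p (casoratian b j) := by
  haveI : Fact p.Prime := ⟨hprime⟩
  have hp2 : p % 2 = 1 := Nat.odd_iff.1 (hprime.odd_of_ne_two (by omega))
  obtain ⟨h0, hb1, hb2, hb3, -, -, -, -, -⟩ := box hb
  have hpd : (p : ℤ) ≤ dOf b := le_of_lt (d_bounds20 hs hP hQ hQ3 hF1 hF2).1
  have hpb : (p : ℤ) ≤ b 0 := by linarith
  rcases Int.emod_two_eq_zero_or_one (b 0) with hr | hr
  · obtain ⟨h1, h2, h3⟩ := checkJ20_ev
    exact cover_J_j hb hj1 hj7 hbj hprime hp5 hpb hpd hwin (cover20_ev hb hs hP hQ hQ3 hF1 hF2 hp5 hp2 hr)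
      (by rw [oddFlag_false hr]; exact h1) (by norm_num) (by rw [oddFlag_false hr]; exact h2) (by rw [oddFlag_false hr]; exact h3)
      (by norm_num) (by norm_num) (by norm_num) (by norm_num) hcas
  · obtain ⟨h1, h2, h3⟩ := checkJ20_od
    exact cover_J_j hb hj1 hj7 hbj hprime hp5 hpb hpd hwin (cover20_od hb hs hP hQ hQ3 hF1 hF2 hp5 hp2 hr)
      (by rw [oddFlag_true hr]; exact h1) (by norm_num) (by rw [oddFlag_true hr]; exact h2) (by rw [oddFlag_true hr]; exact h3)
      (by norm_num) (by norm_num) (by norm_num) (by norm_num) hcas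

/-- **The ORIGIN type-space law at `M = 8` on the `N_p = 20` profile, general `b`**: with `3p ≤ d(b)` (degree condition `6p ≤ 2d + 1`),
`v_p(Cas_j(b)) ≥ −11 = 5 − 2M` (class structure from the covers by `DenomLaw.originClasses_of_cover` with the extended inventory, line data `lineData8x`). -/
theorem cas_ge20_neg11 (hb : InPolytope b) (hs : Sorted7 b) (hbj : InPolytope (shift b j)) (hj1 : 1 ≤ j) (hj7 : j ≤ 7)
    (hprime : p.Prime) (hp5 : 5 ≤ p) (hwin : (b 0 + 2 : ℤ) < (p : ℤ) ^ 2) (hP : (p : ℤ) ≤ b 7) (hQ : b 0 < (p : ℤ) + b 1 + b 2)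
    (hQ3 : (p : ℤ) + b 1 + b 3 ≤ b 0) (hF1 : b 1 < 2 * (p : ℤ)) (hF2 : b 0 < 2 * (p : ℤ) + b 6 + b 7) (hd : 3 * (p : ℤ) ≤ dOf b)
    (hcas : casoratian b j ≠ 0) : (-11 : ℤ) ≤ padicValRat p (casoratian b j) := by
  haveI : Fact p.Prime := ⟨hprime⟩
  have hp2 : p % 2 = 1 := Nat.odd_iff.1 (hprime.odd_of_ne_two (by omega))
  obtain ⟨h0, hb1, hb2, hb3, -, -, -, -, -⟩ := box hb
  have hpb : (p : ℤ) ≤ b 0 := by linarith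
  have hdeg : (p : ℤ) * (((8 : ℕ) : ℤ) - 2) ≤ 2 * dOf b + 1 := by push_cast; linarith
  have hC : OriginWindowClasses b p 8 Ray4Windows.D8 (Ray4Windows.S8 ++ [[1, 1, -6, -4, 1], [1, -4, -6, 1, 1]]) T1Rays.Pc8 := by
    rcases Int.emod_two_eq_zero_or_one (b 0) with hr | hr
    · exact originClasses_of_cover (cover20_ev hb hs hP hQ hQ3 hF1 hF2 hp5 hp2 hr) (by rw [oddFlag_false hr]; decide)
    · exact originClasses_of_cover (cover20_od hb hs hP hQ hQ3 hF1 hF2 hp5 hp2 hr) (by rw [oddFlag_true hr]; decide)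
  have h := originBound_of_classes hb hbj hj1 hj7 hprime hp5 hpb hwin (M := 8) (by norm_num) (by decide) (Ray4Windows.u8_ne hprime) lineData8x hC
    hdeg hcas
  push_cast at h; linarith

end Bounds

/-! ## §4 PATH accounting on the `N_p = 20` profile, every sorted `b` -/

/-- **`PathAccountingFirstPeriod`'s conclusion on the `N_p = 20` profile for EVERY sorted `b`, every direction `j`**: `b` sorted in the polytope with
`b + e_j` in the polytope, a first-period prime `p ≥ 5` with `b₀ + 2 < p²`, all seven parameters reaching `p` (`p ≤ b₇`) and exactly the smallest pair block
short of `p` (`b₀ − b₁ − b₂ < p ≤ b₀ − b₁ − b₃`): `⌊d/p⌋ − N_p − min([⌊d/p⌋ ≥ 2], 5 − C⋆) ≤ v_p(Cas_j(b))`. -/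
theorem pathAccounting_profile20 (b : ℕ → ℤ) (j p : ℕ) (hb : InPolytope b) (hs : Sorted7 b) (hbj : InPolytope (shift b j))
    (hj1 : 1 ≤ j) (hj7 : j ≤ 7) (hprime : p.Prime) (hp5 : 5 ≤ p) (hwin : (b 0 + 2 : ℤ) < (p : ℤ) ^ 2) (hfp : FirstPeriod b p)
    (hP : (p : ℤ) ≤ b 7) (hQ : b 0 < (p : ℤ) + b 1 + b 2) (hQ3 : (p : ℤ) + b 1 + b 3 ≤ b 0) (hcas : casoratian b j ≠ 0) :
    dOf b / (p : ℤ) - pairFloors b p - min (if 2 ≤ dOf b / (p : ℤ) then (1 : ℤ) else 0) (5 - (cStar b p : ℤ))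
      ≤ padicValRat p (casoratian b j) := by
  obtain ⟨hF1, hF2⟩ := fp_bounds hfp
  have hp0 : (0 : ℤ) < p := by exact_mod_cast hprime.pos
  obtain ⟨hdlo, hdhi⟩ := d_bounds20 hs hP hQ hQ3 hF1 hF2
  rw [pairFloors_eq_20 hb hs hprime.pos hQ hQ3 hfp]
  have hC11 : (cStar b p : ℤ) ≤ 11 := by exact_mod_cast cStar_le_eleven b p
  have hmin : -6 ≤ min (if 2 ≤ dOf b / (p : ℤ) then (1 : ℤ) else 0) (5 - (cStar b p : ℤ)) :=
    le_min (by split_ifs <;> norm_num) (by linarith)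
  have hfd4 : dOf b / (p : ℤ) < 4 := by rw [Int.ediv_lt_iff_lt_mul hp0]; linarith
  by_cases h3 : 3 * (p : ℤ) ≤ dOf b
  · linarith [cas_ge20_neg11 hb hs hbj hj1 hj7 hprime hp5 hwin hP hQ hQ3 hF1 hF2 h3 hcas]
  push Not at h3
  have hfd3 : dOf b / (p : ℤ) < 3 := by rw [Int.ediv_lt_iff_lt_mul hp0]; linarith
  by_cases h2 : 2 * (p : ℤ) ≤ dOf b
  · linarith [cas_ge20_neg12 hb hs hbj hj1 hj7 hprime hp5 hwin hP hQ hQ3 hF1 hF2 hcas]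
  push Not at h2
  have hfd2 : dOf b / (p : ℤ) < 2 := by rw [Int.ediv_lt_iff_lt_mul hp0]; linarith
  linarith [cas_ge20_neg13 hb hs hbj hj1 hj7 hprime hp5 hwin hP hQ hQ3 hF1 hF2 hcas]

/-- **THE NODE ON THE `N_p = 20` PROFILE, EVERY SORTED `b`: `PathAccountingFirstPeriod` with its binders VERBATIM plus three hypotheses** — `p ≤ b₇`,
`b₀ < p + b₁ + b₂`, `p + b₁ + b₃ ≤ b₀`.  Brown–Zudilin's prime-by-prime accounting (28)+(30), Casoratian form, one block short of the full profile,
with no ray or family parametrisation. -/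
theorem pathAccountingFirstPeriod_profile20 :
    ∀ (b : ℕ → ℤ) (p : ℕ), InPolytope b → Sorted7 b → InPolytope (shift b 7) →
      p.Prime → 5 ≤ p → (b 0 + 2 : ℤ) < (p : ℤ) ^ 2 → FirstPeriod b p →
      (p : ℤ) ≤ b 7 → b 0 < (p : ℤ) + b 1 + b 2 → (p : ℤ) + b 1 + b 3 ≤ b 0 → casoratian b 7 ≠ 0 →
        dOf b / (p : ℤ) - pairFloors b p - min (if 2 ≤ dOf b / (p : ℤ) then (1 : ℤ) else 0) (5 - (cStar b p : ℤ))
          ≤ padicValRat p (casoratian b 7) :=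
  fun b p hb hs hb7 hprime hp5 hwin hfp hP hQ hQ3 hcas =>
    pathAccounting_profile20 b 7 p hb hs hb7 (by norm_num) (by norm_num) hprime hp5 hwin hfp hP hQ hQ3 hcas

/-- **(CV) on the `N_p = 20` profile, every sorted `b`, every `j`.** -/
theorem profile20CV (b : ℕ → ℤ) (j p : ℕ) (hb : InPolytope b) (hs : Sorted7 b) (hbj : InPolytope (shift b j))
    (hj1 : 1 ≤ j) (hj7 : j ≤ 7) (hprime : p.Prime) (hp5 : 5 ≤ p) (hwin : (b 0 + 2 : ℤ) < (p : ℤ) ^ 2) (hfp : FirstPeriod b p)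
    (hP : (p : ℤ) ≤ b 7) (hQ : b 0 < (p : ℤ) + b 1 + b 2) (hQ3 : (p : ℤ) + b 1 + b 3 ≤ b 0) (hcas : casoratian b j ≠ 0) :
    refund b p - pairFloors b p ≤ padicValRat p (casoratian b j) := by
  linarith [refund_le_pathHead b p (5 - (cStar b p : ℤ)),
    pathAccounting_profile20 b j p hb hs hbj hj1 hj7 hprime hp5 hwin hfp hP hQ hQ3 hcas]

end Summit.KontsevichZagierPeriods.Zeta5Search.FullProfile
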